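/-
COR-CM (cells pub-hodgecm / pub-hodgecm2, stage 2 of the Hodge ladder) — Δ2 BRIDGE, sublemma S1 AT THE PIN, DEFINITION-FREE HALF, keyed by
the LINE OF RECORD (seat d2bridge-prove-1 g1): the `HcmPieces` field `admLiu : ∀ q, adm (dLiu q)` at the pinned dictionary's admissibility
predicate `adm i d := d.IsReflexOfTypeG ι₁ Φ^δ(a_i)` (`Φ^δ(a) = HodgeCM.SignRecipe.lineType a _ _ = {τ | 0 < Im τ(δ_L·a)}`, port
`Model/Binders/JLiuLineType`), for Liu's record shape over `M_μ`, from the ONE orientation hypothesis the Ω-pin also consumes —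
`hΦ : ∀ τ ∈ Φ_μ, 0 < Im τ(δ_L·a)` (`CorCM/D2Bridge/OmegaAtDeltaPrimeLine.lean`, `deltaPos_repOfLine`) — so the keys seat proves it once.
Content: two CM types one inside the other are equal (`cmType_eq_of_subset`); hence `Φ_μ = Φ^δ(a)` under `hΦ` (`cmType_eq_lineType_of_deltaPos`);
hence admissibility at `Φ^δ(a)` (`admLiu_mk_lineType`, R2 = `Transposition.isReflexOfType_of_reflexCMType` at `e := RingEquiv.refl`).
Theorems only: no definition, no instance, no named fact; nothing landed is edited or restated.  FRAMING: HC_CM is NOT proved;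
«Δ2 BRIDGE CLOSED» is NOT claimed; no pointer moves.
-/
import Summits.HodgeConjecture.CorCM.B01.Transposition.Item6PinMatchReflexPairPkg
import Summits.HodgeConjecture.HodgeCM.Model.Binders.JLiuLineType
import Literature.NumberTheory.Automorphic.Liu2021.Def45AsPrinted
import HarnessLib

set_option autoImplicit false

/-!
# Δ2 bridge, S1 at the pin (definition-free), keyed by the Gram scalar `a` of the line of record

* `cmType_eq_of_subset` — CM types `Φ ⊆ Ψ` are equal;
* `cmType_eq_lineType_of_deltaPos` — `∀ τ ∈ Φ_μ, 0 < Im τ(δ_L·a)` ⟹ `Φ_μ = Φ^δ(a)`;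
* `admLiu_mk_lineType` — under that hypothesis the record `⟨↥K*_μ, Ψ*_μ, M_μ, e_μ, A, ιA, θA, Ψ̃_μ, _, hA, (M_μ ⊆ ℂ), α, hα⟩ : LiuCMSide`
  is admissible in the package sense `IsReflexOfTypeG ι₁ Φ^δ(a)`, for every abelian-variety half.

References: Y. Liu, arXiv:2102.11518 = Camb. J. Math. 9 (2021), Def. 4.3 (2) (`FJcycle.tex` l. 1914–1921), Def. 4.5 (2) (l. 1944–1951),
Def. 4.12 (l. 2102–2108); G. Shimura, *Abelian Varieties with Complex Multiplication and Modular Functions* (1998) §8.3 Prop. 28.  HC_CM is NOT proved.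
-/

noncomputable section

open scoped TensorProduct

namespace Summit.HodgeConjecture.CorCM.D2Bridge

open CategoryTheory NumberField
open Literature.AlgebraicGeometry.Motives Literature.AlgebraicGeometry.HodgeTheory
open Literature.AlgebraicGeometry.ComplexMultiplication
open Literature.NumberTheory.ComplexMultiplication Literature.NumberTheory.Automorphic
open Literature.NumberTheory.Automorphic.IdeleClassGroup Literature.NumberTheory.Automorphic.PicardCM
open Literature.NumberTheory.Automorphic.Liu2021
open Literature.NumberTheory.GelbartRogawski1991.UnitaryDualPair (imagUnit)
open HodgeCM.Model (LiuCMSide)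

/-- **Two CM types, one contained in the other, are equal** (each contains exactly one of every conjugate pair). [folklore] -/
theorem cmType_eq_of_subset {E : Type*} [Field E] (Φ Ψ : CMType E) (h : Φ.1 ⊆ Ψ.1) : Φ = Ψ := by
  apply Subtype.ext
  refine Set.Subset.antisymm h fun φ hφ => ?_
  by_contra hn
  have h1 : NumberField.ComplexEmbedding.conjugate φ ∈ Φ.1 := by
    by_contra hc
    exact hn ((Φ.2 φ).2 hc)
  exact ((Ψ.2 φ).1 hφ) (h h1)

section Line

variable {L : HodgeCM.CMField} [IsGalois ℚ L] (ι₁ : L →+* ℂ)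
  {μ : Literature.NumberTheory.Automorphic.IdeleClassGroup L →ₜ* Circle} (hμ : IsConjugateSymplectic L μ)

/-- **`Φ_μ = Φ^δ(a)`** from the orientation hypothesis AT the Gram scalar `a` of the line of record: if `0 < Im τ(δ_L·a)` for every
`τ ∈ Φ_μ` then `Φ_μ ⊆ Φ^δ(a)` (`SignRecipe.mem_lineType_iff`, `eta_eq_imagUnit`), and CM types in inclusion are equal.
[cite: Liu2021, Def. 4.12 (FJcycle.tex l. 2102–2108)] -/
theorem cmType_eq_lineType_of_deltaPos (a : L) (ha : IsCMField.complexConj (L : Type) a = a) (ha0 : a ≠ 0)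
    (hΦ : ∀ τ : L →+* ℂ, τ ∈ hμ.cmType.1 → 0 < (τ (imagUnit (L : Type) * a)).im) :
    hμ.cmType = HodgeCM.SignRecipe.lineType a ha ha0 :=
  cmType_eq_of_subset _ _ fun τ hτ => by
    rw [HodgeCM.SignRecipe.mem_lineType_iff, HodgeCM.SignRecipe.eta_eq_imagUnit]
    exact hΦ τ hτ

/-- **S1 (law) at the pin, keyed by the line of record.**  Under `hΦ : ∀ τ ∈ Φ_μ, 0 < Im τ(δ_L·a)` (the Ω-pin's orientation hypothesis at `a`),
the model CM record with reflex data `(↥K*_μ, Ψ*_μ, M_μ, e_μ, M_μ ⊆ ℂ)` and ANY abelian-variety half `(A, ιA, θA, hA, α, hα)` of CM type the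
inflated reflex type `Ψ̃_μ` is admissible for `Φ^δ(a)` — the pinned dictionary's `adm i` at a line with Gram scalar `a`.
[cite: Liu2021, Def. 4.3 (2) (FJcycle.tex l. 1919), Def. 4.5 (2) (l. 1944–1951), Def. 4.12 (l. 2102–2108)] [cite: Shimura1998, §8.3 Prop. 28] -/
theorem admLiu_mk_lineType (A : AbelianVariety ℂ)
    (ιA : letI := hμ.numberField_muAlgValueField; 𝓞 ↥(muAlgValueField L μ) →+* End A)
    (θA : ↥(muAlgValueField L μ) →+* Module.End ℂ (complexBetti A.X 1))
    (hA : letI := hμ.numberField_muAlgValueField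
      IsCMTypeRealisation (inducedCMType (Def45.incl (AlgHom.id ℚ L) ι₁ hμ) (reflexCMType ι₁ hμ.cmType (AlgHom.id ℚ L))) A ιA θA)
    (α : ℂ ⊗[ℚ] bettiCohomology A.X 1)
    (hα : letI := hμ.numberField_muAlgValueField
      α ∈ eigenline (HodgeCM.CM.CommonReflex.complexify (BettiUniverse.cmAction θA hA.isInducedOnIntegers)) (muAlgValueField L μ).subtype)
    (a : L) (ha : IsCMField.complexConj (L : Type) a = a) (ha0 : a ≠ 0)
    (hΦ : ∀ τ : L →+* ℂ, τ ∈ hμ.cmType.1 → 0 < (τ (imagUnit (L : Type) * a)).im) :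
    ({ K' := ↥(reflexField ℚ L (algValuedIn ι₁ hμ.cmType.1))
       Φ' := (reflexCMType ι₁ hμ.cmType (AlgHom.id ℚ L)).1
       M := ↥(muAlgValueField L μ)
       instNumberFieldM := hμ.numberField_muAlgValueField
       k := Def45.incl (AlgHom.id ℚ L) ι₁ hμ
       A := A, ιA := ιA, θA := θA
       ΦA := inducedCMType (Def45.incl (AlgHom.id ℚ L) ι₁ hμ) (reflexCMType ι₁ hμ.cmType (AlgHom.id ℚ L))
       hΦA := fun θ => mem_inducedCMType_iff _ _ θ
       isRealisation := hA
       τ := (muAlgValueField L μ).subtype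
       α := α, α_mem := hα } : LiuCMSide).IsReflexOfTypeG ι₁ (HodgeCM.SignRecipe.lineType a ha ha0) := by
  rw [← cmType_eq_lineType_of_deltaPos hμ a ha ha0 hΦ]
  exact fun _ => Transposition.isReflexOfType_of_reflexCMType ι₁ hμ.cmType _ (RingEquiv.refl _)
    (RingHom.ext fun k => Def45.coe_incl (AlgHom.id ℚ L) ι₁ hμ k)
    (fun _ => Iff.of_eq (congrArg (fun χ => χ ∈ (reflexCMType ι₁ hμ.cmType (AlgHom.id ℚ L)).1) (RingHom.ext fun _ => rfl)))

end Line

end Summit.HodgeConjecture.CorCM.D2Bridge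

end
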